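import Summits.Ventures.CertifiedManyBodySolver.Downfold.EmeryZoneWeightShell
import HarnessLib

/-!
# The Cu weight of the antibonding band over an ENERGY SHELL, II: the enclosure theorems

Venture CertifiedManyBodySolver, cell `pub/hubbard-downfold` (stage S1; INFLATION-RULES-3to1-B §B.81 THE ORBITAL PARTITION OF THE
HOLES OVER THE ZONE), seat hubbard-downfold-mod-4 (technique B, g33); namespace `Summit.Ventures.CertifiedManyBodySolver.Downfold.Emery`.
Everything PROVED (0 sorry). WHAT THIS IS NOT: a statement about any material; `U = 0` one-body kinematics of the σ model.

Sequel of `EmeryZoneWeightShell` (sextuples `Sext`, σ-model coefficient sextuples, `shellN = weightHarmN`, `shellD = fsN1·(α + 8βs)`).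
Here, with the kernel-evaluable shell quantities `shellDamin`, `shellDtail`, `shellDlo`, `shellQmax`, `shellDelta`, `crossC` (generic
over an ordered field: the kernel evaluates them in `ℚ`, the theorems read them in `ℝ`; `cast_*` lemmas), for `0 ≤ t ≤ h`, `0 ≤ s ≤ 1`:

* `shellDlo_le`: `D(e + t, s) ≥ Dlo(e, h)`; `shellDamin_le`: `D(e, s) ≥ Damin(e)`;
* `abs_cross_le_Qmax`: `|N(e + t, s)·D(e, s) − N(e, s)·D(e + t, s)| ≤ Qmax(e, h)` — the cross numerator is a quintic in `t` with ZERO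
  constant term (`cross_eq_eval`), so the bound is first order in `h` and keeps the `N/D` correlation;
* **`abs_w_sub_le_delta`**: `Dlo > 0 ⇒ |N/D (e + t, s) − N/D (e, s)| ≤ δ(e, h) = Qmax/(Dlo·Damin)`;
* `shell_cross_eq` / **`w_mono_s`**: `N(e, s₂)D(e, s₁) − N(e, s₁)D(e, s₂) = C(e)(s₂ − s₁)` (from `weight_cross_eq`), hence the Möbius
  function `s ↦ N/D(e, s)` is non-decreasing on `[0, 1]` when `C(e) ≥ 0` and `Damin(e) > 0`.

Sources: three-band model [HybertsenSchluterChristensen1989, Eq. (1)]; [AndersenEtAl1995, §6]; interval / Taylor arithmetic [folklore]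
(R. E. Moore, Interval Analysis, 1966, Ch. 3).
-/

namespace Summit.Ventures.CertifiedManyBodySolver.Downfold.Emery

open Real Set

/-! ## §3 The shell enclosure -/

section ShellDefs

variable {R : Type*} [Field R] [LinearOrder R]

/-- `min(D₀(e), D₀(e) + D₁(e))` — lower bound of `D(e, s)` over `s ∈ [0, 1]`. [folklore] -/
def shellDamin (Δ a b c e : R) : R := min ((sD0 Δ a b c).eval e) ((sD0 Δ a b c).eval e + (sD1 Δ a b c).eval e)

/-- Taylor tail of `D(e + t, s)` over `t ∈ [0, h]`, uniformly in `s ∈ [0, 1]`. [folklore] -/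
def shellDtail (Δ a b c e h : R) : R := ((sD0 Δ a b c).shift e).absTail h + ((sD1 Δ a b c).shift e).absTail h

/-- Certified lower bound of `D` on the shell `[e, e + h] × [0, 1]`. [folklore] -/
def shellDlo (Δ a b c e h : R) : R := shellDamin Δ a b c e - shellDtail Δ a b c e h

/-- `|q₀| + |q₁| + |q₂|` for one Taylor order of the cross numerator. [folklore] -/
def qAbs (n0 n1 d0 d1 u0 u1 v0 v1 : R) : R :=
  |d0 * u0 - n0 * v0| + |d1 * u0 + d0 * u1 - n1 * v0 - n0 * v1| + |d1 * u1 - n1 * v1|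

/-- Certified bound of `|N(e + t, s)·D(e, s) − N(e, s)·D(e + t, s)|` on the shell. [folklore] -/
def shellQmax (Δ a b c e h : R) : R :=
  let n0 := (sN0 Δ a b c).eval e
  let n1 := (sN1 Δ a b c).eval e
  let d0 := (sD0 Δ a b c).eval e
  let d1 := (sD1 Δ a b c).eval e
  let U0 := (sN0 Δ a b c).shift e
  let U1 := (sN1 Δ a b c).shift e
  let V0 := (sD0 Δ a b c).shift e
  let V1 := (sD1 Δ a b c).shift e
  h * (qAbs n0 n1 d0 d1 U0.c1 U1.c1 V0.c1 V1.c1 + h * (qAbs n0 n1 d0 d1 U0.c2 U1.c2 V0.c2 V1.c2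
    + h * (qAbs n0 n1 d0 d1 U0.c3 U1.c3 V0.c3 V1.c3 + h * (qAbs n0 n1 d0 d1 U0.c4 U1.c4 V0.c4 V1.c4
    + h * qAbs n0 n1 d0 d1 U0.c5 U1.c5 V0.c5 V1.c5))))

/-- **THE SHELL REMAINDER** `δ = Qmax/(Dlo·Damin)`. [folklore] -/
def shellDelta (Δ a b c e h : R) : R := shellQmax Δ a b c e h / (shellDlo Δ a b c e h * shellDamin Δ a b c e)

/-- The cross coefficient `C(e)`: `N(e, s₂)D(e, s₁) − N(e, s₁)D(e, s₂) = C(e)·(s₂ − s₁)` (`weight_cross_eq`). [folklore] -/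
def crossC (Δ a b c e : R) : R :=
  (4 * a ^ 2 + 2 * e * (b - c)) * (32 * a ^ 2 * (Δ + e) ^ 2 * (b + c) * (a ^ 2 + b * e) * (2 * a ^ 2 + (b - c) * e)
    * (sFsT Δ a b c).eval e)

end ShellDefs

/-! ### Casts of the shell quantities -/

/-- [folklore] -/
theorem cast_shellDamin (Δ a b c e : ℚ) : ((shellDamin Δ a b c e : ℚ) : ℝ) = shellDamin (Δ : ℝ) a b c e := by
  simp only [shellDamin, Rat.cast_min, Rat.cast_add, Sext.cast_eval, map_sD0, map_sD1]

/-- [folklore] -/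
theorem cast_shellDtail (Δ a b c e h : ℚ) : ((shellDtail Δ a b c e h : ℚ) : ℝ) = shellDtail (Δ : ℝ) a b c e h := by
  simp only [shellDtail, Rat.cast_add, Sext.cast_absTail, Sext.map_shift, map_sD0, map_sD1]

/-- [folklore] -/
theorem cast_shellDlo (Δ a b c e h : ℚ) : ((shellDlo Δ a b c e h : ℚ) : ℝ) = shellDlo (Δ : ℝ) a b c e h := by
  simp only [shellDlo, Rat.cast_sub, cast_shellDamin, cast_shellDtail]

/-- [folklore] -/
theorem cast_qAbs (n0 n1 d0 d1 u0 u1 v0 v1 : ℚ) :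
    ((qAbs n0 n1 d0 d1 u0 u1 v0 v1 : ℚ) : ℝ) = qAbs (n0 : ℝ) n1 d0 d1 u0 u1 v0 v1 := by
  simp only [qAbs]; push_cast; rfl

/-- [folklore] -/
theorem cast_shift_c (p : Sext ℚ) (a : ℚ) :
    (((p.shift a).c1 : ℚ) : ℝ) = ((p.map (fun q : ℚ => (q : ℝ))).shift (a : ℝ)).c1 ∧
    (((p.shift a).c2 : ℚ) : ℝ) = ((p.map (fun q : ℚ => (q : ℝ))).shift (a : ℝ)).c2 ∧
    (((p.shift a).c3 : ℚ) : ℝ) = ((p.map (fun q : ℚ => (q : ℝ))).shift (a : ℝ)).c3 ∧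
    (((p.shift a).c4 : ℚ) : ℝ) = ((p.map (fun q : ℚ => (q : ℝ))).shift (a : ℝ)).c4 ∧
    (((p.shift a).c5 : ℚ) : ℝ) = ((p.map (fun q : ℚ => (q : ℝ))).shift (a : ℝ)).c5 := by
  rw [← Sext.map_shift]; simp only [Sext.map, and_self]

/-- [folklore] -/
theorem cast_shellQmax (Δ a b c e h : ℚ) : ((shellQmax Δ a b c e h : ℚ) : ℝ) = shellQmax (Δ : ℝ) a b c e h := by
  obtain ⟨n1, n2, n3, n4, n5⟩ := cast_shift_c (sN0 Δ a b c) e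
  obtain ⟨m1, m2, m3, m4, m5⟩ := cast_shift_c (sN1 Δ a b c) e
  obtain ⟨d1, d2, d3, d4, d5⟩ := cast_shift_c (sD0 Δ a b c) e
  obtain ⟨f1, f2, f3, f4, f5⟩ := cast_shift_c (sD1 Δ a b c) e
  simp only [shellQmax, Rat.cast_mul, Rat.cast_add, cast_qAbs, Sext.cast_eval, n1, n2, n3, n4, n5, m1, m2, m3, m4, m5,
    d1, d2, d3, d4, d5, f1, f2, f3, f4, f5, map_sN0, map_sN1, map_sD0, map_sD1]

/-- [folklore] -/
theorem cast_shellDelta (Δ a b c e h : ℚ) : ((shellDelta Δ a b c e h : ℚ) : ℝ) = shellDelta (Δ : ℝ) a b c e h := by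
  simp only [shellDelta, Rat.cast_div, Rat.cast_mul, cast_shellQmax, cast_shellDlo, cast_shellDamin]

/-- [folklore] -/
theorem cast_crossC (Δ a b c e : ℚ) : ((crossC Δ a b c e : ℚ) : ℝ) = crossC (Δ : ℝ) a b c e := by
  have h : (((sFsT Δ a b c).eval e : ℚ) : ℝ) = (sFsT (Δ : ℝ) a b c).eval (e : ℝ) := by rw [Sext.cast_eval, map_sFsT]
  unfold crossC
  push_cast
  rw [h]

/-! ### The real enclosure theorems -/

/-- `min d₀ (d₀ + d₁) ≤ d₀ + s·d₁` for `s ∈ [0, 1]`. [folklore] -/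
theorem min_le_affine {d0 d1 s : ℝ} (hs : 0 ≤ s) (hs1 : s ≤ 1) : min d0 (d0 + d1) ≤ d0 + s * d1 := by
  rcases le_or_gt 0 d1 with h | h
  · exact (min_le_left _ _).trans (by nlinarith)
  · exact (min_le_right _ _).trans (by nlinarith)

/-- `D(e, s) ≥ Damin(e)` for `s ∈ [0, 1]`. [folklore] -/
theorem shellDamin_le (Δ a b c e : ℝ) {s : ℝ} (hs : 0 ≤ s) (hs1 : s ≤ 1) :
    shellDamin Δ a b c e ≤ shellD Δ a b c e s := by
  unfold shellDamin shellD
  exact min_le_affine hs hs1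

/-- **`D(e + t, s) ≥ Dlo(e, h)`** for `t ∈ [0, h]`, `s ∈ [0, 1]`. [folklore] -/
theorem shellDlo_le (Δ a b c e : ℝ) {h t s : ℝ} (ht : 0 ≤ t) (hth : t ≤ h) (hs : 0 ≤ s) (hs1 : s ≤ 1) :
    shellDlo Δ a b c e h ≤ shellD Δ a b c (e + t) s := by
  unfold shellDlo shellDtail shellD shellDamin
  rw [← Sext.eval_shift (sD0 Δ a b c) e t, ← Sext.eval_shift (sD1 Δ a b c) e t]
  set P := (sD0 Δ a b c).shift e
  set Q := (sD1 Δ a b c).shift e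
  have hP := Sext.abs_eval_sub_le_absTail P ht hth
  have hQ := Sext.abs_eval_sub_le_absTail Q ht hth
  have hP0 : P.c0 = (sD0 Δ a b c).eval e := Sext.shift_c0 _ _
  have hQ0 : Q.c0 = (sD1 Δ a b c).eval e := Sext.shift_c0 _ _
  rw [abs_le] at hP hQ
  have hQt : 0 ≤ Q.absTail h := Sext.absTail_nonneg Q (ht.trans hth)
  have h1 : s * Q.eval t ≥ s * (sD1 Δ a b c).eval e - Q.absTail h := by
    have : s * (Q.eval t - Q.c0) ≥ s * (-Q.absTail h) := by exact mul_le_mul_of_nonneg_left hQ.1 hs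
    nlinarith
  have h2 := min_le_affine (d0 := (sD0 Δ a b c).eval e) (d1 := (sD1 Δ a b c).eval e) hs hs1
  linarith [hP.1]

/-- The cross numerator as a sextuple in `t` (constant term `0`). [folklore] -/
noncomputable def crossSext (Δ a b c e s : ℝ) : Sext ℝ :=
  let n := shellN Δ a b c e s
  let d := shellD Δ a b c e s
  let U0 := (sN0 Δ a b c).shift e
  let U1 := (sN1 Δ a b c).shift e
  let V0 := (sD0 Δ a b c).shift e
  let V1 := (sD1 Δ a b c).shift e
  ⟨0, d * (U0.c1 + s * U1.c1) - n * (V0.c1 + s * V1.c1), d * (U0.c2 + s * U1.c2) - n * (V0.c2 + s * V1.c2),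
    d * (U0.c3 + s * U1.c3) - n * (V0.c3 + s * V1.c3), d * (U0.c4 + s * U1.c4) - n * (V0.c4 + s * V1.c4),
    d * (U0.c5 + s * U1.c5) - n * (V0.c5 + s * V1.c5)⟩

/-- `N(e + t, s)·D(e, s) − N(e, s)·D(e + t, s) = crossSext(e, s)(t)`. [folklore] -/
theorem cross_eq_eval (Δ a b c e s t : ℝ) :
    shellN Δ a b c (e + t) s * shellD Δ a b c e s - shellN Δ a b c e s * shellD Δ a b c (e + t) s =
      (crossSext Δ a b c e s).eval t := by
  have hN : shellN Δ a b c (e + t) s = ((sN0 Δ a b c).shift e).eval t + s * ((sN1 Δ a b c).shift e).eval t := by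
    unfold shellN; rw [Sext.eval_shift, Sext.eval_shift]
  have hD : shellD Δ a b c (e + t) s = ((sD0 Δ a b c).shift e).eval t + s * ((sD1 Δ a b c).shift e).eval t := by
    unfold shellD; rw [Sext.eval_shift, Sext.eval_shift]
  have hn : shellN Δ a b c e s = ((sN0 Δ a b c).shift e).c0 + s * ((sN1 Δ a b c).shift e).c0 := by
    unfold shellN; rw [Sext.shift_c0, Sext.shift_c0]
  have hd : shellD Δ a b c e s = ((sD0 Δ a b c).shift e).c0 + s * ((sD1 Δ a b c).shift e).c0 := by
    unfold shellD; rw [Sext.shift_c0, Sext.shift_c0]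
  rw [hN, hD]
  simp only [crossSext]
  rw [hn, hd]
  simp only [Sext.eval]
  ring

/-- `|q₀ + s q₁ + s² q₂| ≤ |q₀| + |q₁| + |q₂|` for `s ∈ [0, 1]`, in the product form of `crossSext`. [folklore] -/
theorem abs_cross_coeff_le {n0 n1 d0 d1 u0 u1 v0 v1 s : ℝ} (hs : 0 ≤ s) (hs1 : s ≤ 1) :
    |(d0 + s * d1) * (u0 + s * u1) - (n0 + s * n1) * (v0 + s * v1)| ≤ qAbs n0 n1 d0 d1 u0 u1 v0 v1 := by
  unfold qAbs
  have e : (d0 + s * d1) * (u0 + s * u1) - (n0 + s * n1) * (v0 + s * v1) =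
      (d0 * u0 - n0 * v0) + s * (d1 * u0 + d0 * u1 - n1 * v0 - n0 * v1) + s ^ 2 * (d1 * u1 - n1 * v1) := by ring
  rw [e]
  have hs2 : s ^ 2 ≤ 1 := by nlinarith
  calc |(d0 * u0 - n0 * v0) + s * (d1 * u0 + d0 * u1 - n1 * v0 - n0 * v1) + s ^ 2 * (d1 * u1 - n1 * v1)|
      ≤ |d0 * u0 - n0 * v0| + |s * (d1 * u0 + d0 * u1 - n1 * v0 - n0 * v1)| + |s ^ 2 * (d1 * u1 - n1 * v1)| :=
        abs_add_three _ _ _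
    _ = |d0 * u0 - n0 * v0| + s * |d1 * u0 + d0 * u1 - n1 * v0 - n0 * v1| + s ^ 2 * |d1 * u1 - n1 * v1| := by
        rw [abs_mul, abs_mul, abs_of_nonneg hs, abs_of_nonneg (sq_nonneg s)]
    _ ≤ |d0 * u0 - n0 * v0| + 1 * |d1 * u0 + d0 * u1 - n1 * v0 - n0 * v1| + 1 * |d1 * u1 - n1 * v1| := by
        gcongr
    _ = _ := by ring

/-- **`|N(e + t, s)D(e, s) − N(e, s)D(e + t, s)| ≤ Qmax(e, h)`** for `t ∈ [0, h]`, `s ∈ [0, 1]`. [folklore] -/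
theorem abs_cross_le_Qmax (Δ a b c e : ℝ) {h t s : ℝ} (ht : 0 ≤ t) (hth : t ≤ h) (hs : 0 ≤ s) (hs1 : s ≤ 1) :
    |shellN Δ a b c (e + t) s * shellD Δ a b c e s - shellN Δ a b c e s * shellD Δ a b c (e + t) s| ≤
      shellQmax Δ a b c e h := by
  rw [cross_eq_eval]
  have hh : 0 ≤ h := ht.trans hth
  have h0 : (crossSext Δ a b c e s).c0 = 0 := rfl
  have h1 := Sext.abs_eval_sub_le_absTail (crossSext Δ a b c e s) ht hth
  rw [h0, sub_zero] at h1
  refine h1.trans ?_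
  have hn : shellN Δ a b c e s = (sN0 Δ a b c).eval e + s * (sN1 Δ a b c).eval e := rfl
  have hd : shellD Δ a b c e s = (sD0 Δ a b c).eval e + s * (sD1 Δ a b c).eval e := rfl
  unfold shellQmax
  refine Sext.absTail_le_of_abs_le hh ?_ ?_ ?_ ?_ ?_ <;>
    · simp only [crossSext]; rw [hn, hd]; exact abs_cross_coeff_le hs hs1

/-- **THE SHELL ENCLOSURE**: if `Dlo(e, h) > 0` then for `t ∈ [0, h]`, `s ∈ [0, 1]`:
`|N(e + t, s)/D(e + t, s) − N(e, s)/D(e, s)| ≤ δ(e, h)`. [folklore] -/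
theorem abs_w_sub_le_delta (Δ a b c e : ℝ) {h t s : ℝ} (hDlo : 0 < shellDlo Δ a b c e h) (ht : 0 ≤ t) (hth : t ≤ h)
    (hs : 0 ≤ s) (hs1 : s ≤ 1) :
    |shellN Δ a b c (e + t) s / shellD Δ a b c (e + t) s - shellN Δ a b c e s / shellD Δ a b c e s| ≤
      shellDelta Δ a b c e h := by
  have hh : 0 ≤ h := ht.trans hth
  have hT : 0 ≤ shellDtail Δ a b c e h := by
    unfold shellDtail
    exact add_nonneg (Sext.absTail_nonneg _ hh) (Sext.absTail_nonneg _ hh)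
  have hDamin : 0 < shellDamin Δ a b c e := by unfold shellDlo at hDlo; linarith
  have hD1 : shellDlo Δ a b c e h ≤ shellD Δ a b c (e + t) s := shellDlo_le Δ a b c e ht hth hs hs1
  have hD0 : shellDamin Δ a b c e ≤ shellD Δ a b c e s := shellDamin_le Δ a b c e hs hs1
  have hD1p : 0 < shellD Δ a b c (e + t) s := hDlo.trans_le hD1
  have hD0p : 0 < shellD Δ a b c e s := hDamin.trans_le hD0
  rw [div_sub_div _ _ hD1p.ne' hD0p.ne', abs_div, abs_of_pos (mul_pos hD1p hD0p)]
  have hQ := abs_cross_le_Qmax Δ a b c e ht hth hs hs1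
  have hQ0 : 0 ≤ shellQmax Δ a b c e h := (abs_nonneg _).trans hQ
  unfold shellDelta
  calc |shellN Δ a b c (e + t) s * shellD Δ a b c e s - shellD Δ a b c (e + t) s * shellN Δ a b c e s| /
        (shellD Δ a b c (e + t) s * shellD Δ a b c e s)
      ≤ shellQmax Δ a b c e h / (shellD Δ a b c (e + t) s * shellD Δ a b c e s) := by
        gcongr; rwa [mul_comm (shellD Δ a b c (e + t) s) (shellN Δ a b c e s)]
    _ ≤ shellQmax Δ a b c e h / (shellDlo Δ a b c e h * shellDamin Δ a b c e) := by
        gcongr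

/-- The cross identity in shell form: `N(e, s₂)D(e, s₁) − N(e, s₁)D(e, s₂) = C(e)·(s₂ − s₁)`. [folklore] -/
theorem shell_cross_eq (Δ a b c e s₁ s₂ : ℝ) :
    shellN Δ a b c e s₂ * shellD Δ a b c e s₁ - shellN Δ a b c e s₁ * shellD Δ a b c e s₂ = crossC Δ a b c e * (s₂ - s₁) := by
  rw [shellN_eq_weightHarmN, shellN_eq_weightHarmN, shellD_eq, shellD_eq]
  unfold crossC
  rw [eval_sFsT]
  have key := weight_cross_eq Δ a b c e s₁ s₂
  unfold fsN1
  linear_combination (4 * a ^ 2 + 2 * e * (b - c)) * key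

/-- **MÖBIUS MONOTONICITY IN THE HARMONIC at fixed energy**: `C(e) ≥ 0`, `Damin(e) > 0`, `0 ≤ s₁ ≤ s₂ ≤ 1` ⇒
`N(e, s₁)/D(e, s₁) ≤ N(e, s₂)/D(e, s₂)`. [folklore] -/
theorem w_mono_s (Δ a b c e : ℝ) {s₁ s₂ : ℝ} (hC : 0 ≤ crossC Δ a b c e) (hDamin : 0 < shellDamin Δ a b c e)
    (h1 : 0 ≤ s₁) (h12 : s₁ ≤ s₂) (h2 : s₂ ≤ 1) :
    shellN Δ a b c e s₁ / shellD Δ a b c e s₁ ≤ shellN Δ a b c e s₂ / shellD Δ a b c e s₂ := by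
  have hD1 : 0 < shellD Δ a b c e s₁ := hDamin.trans_le (shellDamin_le Δ a b c e h1 (h12.trans h2))
  have hD2 : 0 < shellD Δ a b c e s₂ := hDamin.trans_le (shellDamin_le Δ a b c e (h1.trans h12) h2)
  rw [div_le_div_iff₀ hD1 hD2, ← sub_nonneg]
  have := shell_cross_eq Δ a b c e s₁ s₂
  have h : 0 ≤ crossC Δ a b c e * (s₂ - s₁) := mul_nonneg hC (sub_nonneg.2 h12)
  linarith

end Summit.Ventures.CertifiedManyBodySolver.Downfold.Emery
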